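import Literature.Algebra.EuclideanLattices.MRGapCVPRun
import Literature.Algebra.EuclideanLattices.MRGapCVPWitnessCond
import Literature.Probability.Distributions.BindExpectation
import Literature.Probability.Distributions.BindLintegral
import Literature.Probability.Distributions.FirstSuccessBlocks
import HarnessLib

/-!
# The witness law of MR07 Thm. 5.23: the output of `W` conditioned on success, and the transfer of per-condition bounds — proved

Topic `Algebra/EuclideanLattices` (family `pqc`). Micciancio–Regev 2007, proof of Thm. 5.23 (authors'
version pp. 29–31): the verifier is fed `N` independent outputs of `W`, i.e. samples of the law `D` of
`w = x − Yz` CONDITIONED on `W` not aborting; eqs. (16)–(18) are proved "conditioning on `C`, `A`, `z`"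
and then hold for `D` because `D` is a mixture of those conditional laws. This file makes that passage
precise for the idealised run `wRun` (`MRGapCVPRun.lean`):

* `firstStage` (definition with body) — the law `P₁` of the first stage `((c̄, h), (A, z))` of a
  zero-shift run; `experiment_zero_eq_pairing` — the experiment is the pairing `P₁ ⋉ condLaw`
  (stage swap `PMF.bind_bind_map_comm`); `map_fst_pairing`; `query_eq_of_mem_support_firstStage`,
  `output_mem_of_isSolution'` — on the support the matrix is the true query and an `SIS′` answer makes
  every output a lattice vector;
* `tsum_wRun_some_toReal_mul` — **Fubini for the success part of `wRun`** (bounded `f : V → ℝ`);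
* `one_sub_wRun_none` (+ `_toReal`) — `1 − Pr[abort] = P₁[SIS′ answer]`;
* `tsum_wRun_some_toReal_mul_le`, `tsum_cond_toReal_mul_le` — **per-condition bounds transfer** to the
  success part and to the CONDITIONAL law `D` (`Pr[wRun = w] = Pr[¬abort]·D(w)`): `E_D[f] ≤ B`
  (real, bounded `f`: eqs. (16), (17));
* `tsum_wRun_some_mul_le`, `tsum_cond_mul_le` — the same in `ℝ≥0∞` for any `g : V → ℝ≥0∞`
  (eq. (18), second moments).

## References

* D. Micciancio, O. Regev, *Worst-case to average-case reductions based on Gaussian measures*,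
  SIAM J. Comput. 37 (2007) 267–302; authors' version, proof of Thm. 5.23, pp. 29–31 ("let `w₁,…,w_N`
  be the first `N` successful outputs … conditioning on `C`, `A`, `z`").
-/

noncomputable section

open Finset Module Submodule

namespace Literature.Algebra.EuclideanLattices

namespace MicciancioRegev2007

section WitnessLaw

open scoped ENNReal Classical Real
open MeasureTheory PMF Literature.Probability.Distributions Literature.Computability.Cryptography
  Literature.Computability.Cryptography.SIS

variable {V : Type*} [NormedAddCommGroup V] [InnerProductSpace ℝ V] [FiniteDimensional ℝ V]
  [MeasurableSpace V] [BorelSpace V]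
variable {n : ℕ} (b : Basis (Fin n) ℝ V) (q d : ℕ) [NeZero q] [NeZero d]
variable (L : Submodule ℤ V) [DiscreteTopology L] [IsZLattice ℝ L]
variable (rep : (Fin n → ZMod (q * d)) ⧸ gridImage b (q * d) L → span ℤ (Set.range b))
variable {m : ℕ}

/-! ### Generic: marginals and success parts -/

/-- The first marginal of a pairing `p ⋉ κ` is `p`. [folklore] -/
theorem map_fst_pairing {α γ : Type*} (p : PMF α) (κ : α → PMF γ) :
    (p.bind fun a => (κ a).map (Prod.mk a)).map Prod.fst = p := by
  rw [PMF.map_bind]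
  conv_rhs => rw [← PMF.bind_pure p]
  refine congrArg p.bind (funext fun a => ?_)
  rw [PMF.map_comp]
  exact PMF.map_const _ _

/-- The success part of a sum over `Option`: `∑_w G(some w) = ∑_o G(o)` when `G none = 0`. [folklore] -/
theorem tsum_some_eq_tsum {γ M : Type*} [AddCommMonoid M] [TopologicalSpace M] (G : Option γ → M)
    (h0 : G none = 0) : ∑' w, G (some w) = ∑' o, G o := by
  refine (Option.some_injective γ).tsum_eq fun o ho => ?_
  rw [Function.mem_support] at ho
  cases o with
  | none => exact (ho h0).elim
  | some w => exact ⟨w, rfl⟩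

/-! ### The first stage and the pairing form of the zero-shift experiment -/

/-- **The law of the first stage `((c̄, h), (A, z))` of a zero-shift run of `W`**: classes and
lattice classes, then the (deterministic) query and the oracle's answer.
[cite: MicciancioRegev2007, Thm. 5.23 (proof, p. 30: "conditioning on C, A, z")] -/
def firstStage (hSL : ∀ j, ((q * d : ℕ) : ℝ) • b j ∈ L) (hrep : ∀ a, gridClass b (q * d) L (rep a) = a)
    (O : Matrix (Fin n) (Fin m) (ZMod q) → PMF (Fin m → ℤ)) (s : ℝ) :
    PMF (((Fin m → (Fin n → ZMod (q * d)) ⧸ gridImage b (q * d) L) ×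
        (Fin m → (QuotientAddGroup.mk' (gridImage b (q * d) L)).ker)) ×
      (Matrix (Fin n) (Fin m) (ZMod q) × (Fin m → ℤ))) :=
  ((indepLaw m fun _ => offsetLaw b q d L rep hSL hrep s 0).bind fun cbar =>
      (PMF.uniformOfFintype (Fin m → (QuotientAddGroup.mk' (gridImage b (q * d) L)).ker)).map
        (Prod.mk cbar)).bind
    fun ch => ((PMF.pure (queryMatrix b q d L rep ch.1 ch.2)).bind fun A => (O A).map (Prod.mk A)).map
      (Prod.mk ch)

omit [MeasurableSpace V] [BorelSpace V] [IsZLattice ℝ L] in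
/-- **The zero-shift experiment is the pairing of its first stage with `condLaw`.**
[cite: MicciancioRegev2007, Thm. 5.23 (proof, p. 30)] -/
theorem experiment_zero_eq_pairing (hSL : ∀ j, ((q * d : ℕ) : ℝ) • b j ∈ L)
    (hrep : ∀ a, gridClass b (q * d) L (rep a) = a) (O : Matrix (Fin n) (Fin m) (ZMod q) → PMF (Fin m → ℤ))
    (s : ℝ) :
    experiment b q d L rep hSL hrep O s (fun _ => (0 : V)) =
      (firstStage b q d L rep hSL hrep O s).bind
        fun cr => (condLaw b q d L rep s (fun _ => (0 : V)) cr.1.1).map (Prod.mk cr) := by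
  rw [experiment, firstStage]
  exact PMF.bind_bind_map_comm _ _ _

omit [MeasurableSpace V] [BorelSpace V] [IsZLattice ℝ L] [DiscreteTopology L] in
/-- On the support of the first stage the matrix is the true query. [folklore] -/
theorem query_eq_of_mem_support_firstStage (hSL : ∀ j, ((q * d : ℕ) : ℝ) • b j ∈ L)
    (hrep : ∀ a, gridClass b (q * d) L (rep a) = a) (O : Matrix (Fin n) (Fin m) (ZMod q) → PMF (Fin m → ℤ))
    (s : ℝ) {cr} (hcr : cr ∈ (firstStage b q d L rep hSL hrep O s).support) :
    cr.2.1 = queryMatrix b q d L rep cr.1.1 cr.1.2 := by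
  simp only [firstStage, PMF.mem_support_bind_iff, PMF.support_map, Set.mem_image, PMF.support_pure,
    Set.mem_singleton_iff] at hcr
  obtain ⟨ch, -, az, ⟨A, rfl, z, -, rfl⟩, rfl⟩ := hcr
  rfl

omit [MeasurableSpace V] [BorelSpace V] [IsZLattice ℝ L] [DiscreteTopology L] [FiniteDimensional ℝ V] in
/-- **An `SIS′` answer to the true query makes every output a lattice vector** (Lemma 5.8 (ii) on the
grid, for all `y`). [cite: MicciancioRegev2007, Thm. 5.23 (proof, p. 29: "w = x − Yz ∈ L(B)*")] -/
theorem output_mem_of_isSolution' (hSL : ∀ j, ((q * d : ℕ) : ℝ) • b j ∈ L)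
    (cbar : Fin m → (Fin n → ZMod (q * d)) ⧸ gridImage b (q * d) L)
    (hv : Fin m → (QuotientAddGroup.mk' (gridImage b (q * d) L)).ker) {β : ℝ} {z : Fin m → ℤ}
    (hsol : IsSolution' (queryMatrix b q d L rep cbar hv) β z) (y : Fin m → L) :
    output b q d L rep (((cbar, hv), (queryMatrix b q d L rep cbar hv, z)), y) ∈ L := by
  have hxL : combineOutput b q d L rep cbar hv z ∈ L :=
    combine_mem_grid b L q d hSL (fun i => rep (cbar i))
      (fun i => (QuotientAddGroup.ker_mk' (gridImage b (q * d) L)).le (hv i).2)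
      (dvd_of_queryMatrix_mulVec_eq_zero b q d L rep cbar hv hsol.2.1)
  change combineOutput b q d L rep cbar hv z - ∑ i, (z i : ℝ) • ((y i : L) : V) ∈ L
  refine L.sub_mem hxL (Submodule.sum_mem _ fun i _ => ?_)
  rw [Int.cast_smul_eq_zsmul]
  exact L.smul_mem (z i) (y i).2

/-! ### Fubini for the success part of `wRun` (real, bounded) -/

omit [MeasurableSpace V] [BorelSpace V] [IsZLattice ℝ L] in
/-- **The success part of `wRun` as an iterated sum over the first stage and `condLaw`**: for bounded
`f : V → ℝ`, `∑_w Pr[wRun = w] f(w) = ∑_{cr} P₁(cr) ∑_y condLaw(y) [success] f(output)`.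
[cite: MicciancioRegev2007, Thm. 5.23 (proof, p. 30)] -/
theorem tsum_wRun_some_toReal_mul (hSL : ∀ j, ((q * d : ℕ) : ℝ) • b j ∈ L)
    (hrep : ∀ a, gridClass b (q * d) L (rep a) = a) (O : Matrix (Fin n) (Fin m) (ZMod q) → PMF (Fin m → ℤ))
    (s β : ℝ) (f : V → ℝ) {M : ℝ} (hM : 0 ≤ M) (hf : ∀ v, |f v| ≤ M) :
    ∑' w, ((wRun b q d L rep hSL hrep O s β) (some w)).toReal * f (w : V) =
      ∑' cr, ((firstStage b q d L rep hSL hrep O s) cr).toReal *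
        ∑' y, ((condLaw b q d L rep s (fun _ => (0 : V)) cr.1.1) y).toReal *
          (if IsSolution' cr.2.1 β cr.2.2 ∧ output b q d L rep (cr, y) ∈ L
            then f (output b q d L rep (cr, y)) else 0) := by
  have hG : ∀ o : Option L, |o.elim 0 (fun w : L => f (w : V))| ≤ M := by
    rintro (_ | w)
    · simpa using hM
    · exact hf _
  have hGF : ∀ ω : (((Fin m → (Fin n → ZMod (q * d)) ⧸ gridImage b (q * d) L) ×
      (Fin m → (QuotientAddGroup.mk' (gridImage b (q * d) L)).ker)) ×
      (Matrix (Fin n) (Fin m) (ZMod q) × (Fin m → ℤ))) × (Fin m → L),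
      |(if h : IsSolution' ω.1.2.1 β ω.1.2.2 ∧ output b q d L rep ω ∈ L then some (⟨_, h.2⟩ : L)
        else none).elim 0 (fun w : L => f (w : V))| ≤ M := fun ω => hG _
  have h1 : ∑' w, ((wRun b q d L rep hSL hrep O s β) (some w)).toReal * f (w : V) =
      ∑' o, ((wRun b q d L rep hSL hrep O s β) o).toReal * o.elim 0 (fun w : L => f (w : V)) :=
    tsum_some_eq_tsum (fun o => ((wRun b q d L rep hSL hrep O s β) o).toReal *
      o.elim 0 (fun w : L => f (w : V))) (by simp)
  rw [h1, wRun, tsum_toReal_map_mul _ _ hG, experiment_zero_eq_pairing b q d L rep hSL hrep O s,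
    tsum_toReal_bind_mul _ _ hGF]
  refine tsum_congr fun cr => ?_
  congr 1
  rw [tsum_toReal_map_mul _ _ hGF]
  refine tsum_congr fun y => ?_
  congr 1
  split_ifs <;> rfl

/-! ### The non-abort probability through the first stage -/

omit [MeasurableSpace V] [BorelSpace V] [IsZLattice ℝ L] in
/-- **`1 − Pr[abort] = P₁[SIS′ answer]`** (in `ℝ≥0∞`). [cite: MicciancioRegev2007, Thm. 5.23 (proof, p. 30)] -/
theorem one_sub_wRun_none (hSL : ∀ j, ((q * d : ℕ) : ℝ) • b j ∈ L)
    (hrep : ∀ a, gridClass b (q * d) L (rep a) = a) (O : Matrix (Fin n) (Fin m) (ZMod q) → PMF (Fin m → ℤ))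
    (s β : ℝ) :
    1 - (wRun b q d L rep hSL hrep O s β) none =
      (firstStage b q d L rep hSL hrep O s).toOuterMeasure {cr | IsSolution' cr.2.1 β cr.2.2} := by
  set E := experiment b q d L rep hSL hrep O s (fun _ => (0 : V)) with hE
  have hnone : (wRun b q d L rep hSL hrep O s β) none =
      E.toOuterMeasure {ω | IsSolution' ω.1.2.1 β ω.1.2.2 ∧ output b q d L rep ω ∈ L}ᶜ := by
    rw [← PMF.toOuterMeasure_apply_singleton, wRun, PMF.toOuterMeasure_map_apply]
    congr 1
    ext ω
    simp only [Set.mem_preimage, Set.mem_singleton_iff, Set.mem_compl_iff, Set.mem_setOf_eq]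
    split_ifs with h <;> simp [h]
  have hadd : E.toOuterMeasure {ω | IsSolution' ω.1.2.1 β ω.1.2.2 ∧ output b q d L rep ω ∈ L} +
      E.toOuterMeasure {ω | IsSolution' ω.1.2.1 β ω.1.2.2 ∧ output b q d L rep ω ∈ L}ᶜ = 1 := by
    rw [PMF.toOuterMeasure_apply, PMF.toOuterMeasure_apply, ← ENNReal.tsum_add, ← E.tsum_coe]
    exact tsum_congr fun x => Set.indicator_self_add_compl_apply _ _ _
  have hsub1 : 1 - (wRun b q d L rep hSL hrep O s β) none =
      E.toOuterMeasure {ω | IsSolution' ω.1.2.1 β ω.1.2.2 ∧ output b q d L rep ω ∈ L} := by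
    rw [hnone]
    exact ENNReal.sub_eq_of_eq_add (PMF.toOuterMeasure_ne_top E _) hadd.symm
  have hsupp : {ω | IsSolution' ω.1.2.1 β ω.1.2.2} ∩ E.support ⊆
      {ω | IsSolution' ω.1.2.1 β ω.1.2.2 ∧ output b q d L rep ω ∈ L} := by
    rintro ⟨⟨⟨cbar, hv⟩, ⟨A, z⟩⟩, y⟩ ⟨hsol, hmem⟩
    have hA : A = queryMatrix b q d L rep cbar hv := query_eq_of_mem_support b q d L rep hSL hrep O s _ hmem
    simp only [Set.mem_setOf_eq] at hsol ⊢
    subst hA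
    exact ⟨hsol, output_mem_of_isSolution' b q d L rep hSL cbar hv hsol y⟩
  have heq : E.toOuterMeasure {ω | IsSolution' ω.1.2.1 β ω.1.2.2 ∧ output b q d L rep ω ∈ L} =
      E.toOuterMeasure {ω | IsSolution' ω.1.2.1 β ω.1.2.2} :=
    le_antisymm (E.toOuterMeasure_mono (Set.inter_subset_left.trans fun ω hω => hω.1))
      (E.toOuterMeasure_mono hsupp)
  rw [hsub1, heq, hE, experiment_zero_eq_pairing b q d L rep hSL hrep O s,
    show {ω : (((Fin m → (Fin n → ZMod (q * d)) ⧸ gridImage b (q * d) L) ×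
        (Fin m → (QuotientAddGroup.mk' (gridImage b (q * d) L)).ker)) ×
        (Matrix (Fin n) (Fin m) (ZMod q) × (Fin m → ℤ))) × (Fin m → L) | IsSolution' ω.1.2.1 β ω.1.2.2} =
      Prod.fst ⁻¹' {cr | IsSolution' cr.2.1 β cr.2.2} from rfl,
    ← PMF.toOuterMeasure_map_apply, map_fst_pairing]

omit [MeasurableSpace V] [BorelSpace V] [IsZLattice ℝ L] in
/-- Real form: `1 − Pr[abort] = P₁[SIS′ answer]`. [folklore] -/
theorem one_sub_wRun_none_toReal (hSL : ∀ j, ((q * d : ℕ) : ℝ) • b j ∈ L)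
    (hrep : ∀ a, gridClass b (q * d) L (rep a) = a) (O : Matrix (Fin n) (Fin m) (ZMod q) → PMF (Fin m → ℤ))
    (s β : ℝ) :
    1 - ((wRun b q d L rep hSL hrep O s β) none).toReal =
      ((firstStage b q d L rep hSL hrep O s).toOuterMeasure {cr | IsSolution' cr.2.1 β cr.2.2}).toReal := by
  rw [← one_sub_wRun_none, ENNReal.toReal_sub_of_le ((wRun b q d L rep hSL hrep O s β).coe_le_one _)
    ENNReal.one_ne_top, ENNReal.toReal_one]

/-! ### Transfer of per-condition bounds (real, bounded) -/

omit [MeasurableSpace V] [BorelSpace V] [IsZLattice ℝ L] in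
/-- **Per-condition bounds transfer to the success part of `wRun`**: if for every first-stage value
in the support whose answer is an `SIS′` solution the conditional expectation of `f(output)` over
`y ∼ condLaw` is at most `B ≥ 0` (`f` bounded), then `∑_w Pr[wRun = w] f(w) ≤ B · P₁[SIS′ answer]`.
[cite: MicciancioRegev2007, Thm. 5.23 (proof, p. 30: bounds "conditioned on C, A, z" pass to w)] -/
theorem tsum_wRun_some_toReal_mul_le (hSL : ∀ j, ((q * d : ℕ) : ℝ) • b j ∈ L)
    (hrep : ∀ a, gridClass b (q * d) L (rep a) = a) (O : Matrix (Fin n) (Fin m) (ZMod q) → PMF (Fin m → ℤ))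
    (s β : ℝ) (f : V → ℝ) {M : ℝ} (hM : 0 ≤ M) (hf : ∀ v, |f v| ≤ M) {B : ℝ} (hB : 0 ≤ B)
    (hcond : ∀ (cbar : Fin m → (Fin n → ZMod (q * d)) ⧸ gridImage b (q * d) L)
      (hv : Fin m → (QuotientAddGroup.mk' (gridImage b (q * d) L)).ker) (z : Fin m → ℤ),
      ((cbar, hv), (queryMatrix b q d L rep cbar hv, z)) ∈ (firstStage b q d L rep hSL hrep O s).support →
      IsSolution' (queryMatrix b q d L rep cbar hv) β z →
      ∑' y, ((condLaw b q d L rep s (fun _ => (0 : V)) cbar) y).toReal *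
        f (output b q d L rep (((cbar, hv), (queryMatrix b q d L rep cbar hv, z)), y)) ≤ B) :
    ∑' w, ((wRun b q d L rep hSL hrep O s β) (some w)).toReal * f (w : V) ≤
      B * ((firstStage b q d L rep hSL hrep O s).toOuterMeasure {cr | IsSolution' cr.2.1 β cr.2.2}).toReal := by
  set P₁ := firstStage b q d L rep hSL hrep O s with hP₁
  rw [tsum_wRun_some_toReal_mul b q d L rep hSL hrep O s β f hM hf]
  set inner : (((Fin m → (Fin n → ZMod (q * d)) ⧸ gridImage b (q * d) L) ×
      (Fin m → (QuotientAddGroup.mk' (gridImage b (q * d) L)).ker)) ×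
      (Matrix (Fin n) (Fin m) (ZMod q) × (Fin m → ℤ))) → ℝ := fun cr =>
    ∑' y, ((condLaw b q d L rep s (fun _ => (0 : V)) cr.1.1) y).toReal *
      (if IsSolution' cr.2.1 β cr.2.2 ∧ output b q d L rep (cr, y) ∈ L
        then f (output b q d L rep (cr, y)) else 0) with hinner
  have hib : ∀ cr, |inner cr| ≤ M := fun cr =>
    abs_tsum_toReal_mul_le _ fun y => by
      split_ifs
      · exact hf _
      · simpa using hM
  have hpt : ∀ cr, (P₁ cr).toReal * inner cr ≤
      B * {cr | IsSolution' cr.2.1 β cr.2.2}.indicator (fun cr => (P₁ cr).toReal) cr := by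
    intro cr
    by_cases hcr : cr ∈ P₁.support
    · obtain ⟨⟨cbar, hv⟩, ⟨A, z⟩⟩ := cr
      have hA : A = queryMatrix b q d L rep cbar hv :=
        query_eq_of_mem_support_firstStage b q d L rep hSL hrep O s hcr
      subst hA
      by_cases hsol : IsSolution' (queryMatrix b q d L rep cbar hv) β z
      · rw [Set.indicator_of_mem (show ((cbar, hv), (queryMatrix b q d L rep cbar hv, z)) ∈
          {cr : ((Fin m → (Fin n → ZMod (q * d)) ⧸ gridImage b (q * d) L) ×
            (Fin m → (QuotientAddGroup.mk' (gridImage b (q * d) L)).ker)) ×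
            (Matrix (Fin n) (Fin m) (ZMod q) × (Fin m → ℤ)) | IsSolution' cr.2.1 β cr.2.2} from hsol),
          mul_comm B]
        refine mul_le_mul_of_nonneg_left ?_ ENNReal.toReal_nonneg
        have hin : inner ((cbar, hv), (queryMatrix b q d L rep cbar hv, z)) =
            ∑' y, ((condLaw b q d L rep s (fun _ => (0 : V)) cbar) y).toReal *
              f (output b q d L rep (((cbar, hv), (queryMatrix b q d L rep cbar hv, z)), y)) := by
          rw [hinner]
          refine tsum_congr fun y => ?_
          rw [if_pos ⟨hsol, output_mem_of_isSolution' b q d L rep hSL cbar hv hsol y⟩]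
        rw [hin]
        exact hcond cbar hv z hcr hsol
      · have hin : inner ((cbar, hv), (queryMatrix b q d L rep cbar hv, z)) = 0 := by
          rw [hinner]
          simp only [hsol, false_and, if_false, mul_zero, tsum_zero]
        rw [hin, mul_zero]
        exact mul_nonneg hB (Set.indicator_nonneg (fun _ _ => ENNReal.toReal_nonneg) _)
    · rw [(PMF.apply_eq_zero_iff P₁ cr).2 hcr, ENNReal.toReal_zero, zero_mul]
      exact mul_nonneg hB (Set.indicator_nonneg (fun _ _ => ENNReal.toReal_nonneg) _)
  have hs1 : Summable fun cr => (P₁ cr).toReal * inner cr := summable_toReal_mul_of_bounded P₁ hib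
  have hs2 : Summable fun cr =>
      B * {cr | IsSolution' cr.2.1 β cr.2.2}.indicator (fun cr => (P₁ cr).toReal) cr :=
    ((summable_coe_toReal P₁).indicator _).mul_left B
  refine (hs1.tsum_le_tsum hpt hs2).trans (le_of_eq ?_)
  rw [tsum_mul_left, toReal_toOuterMeasure_apply]

omit [MeasurableSpace V] [BorelSpace V] [IsZLattice ℝ L] in
/-- **Eqs. (16)/(17)-type bounds for the conditional witness law `D`** (`Pr[wRun = w] = Pr[¬abort]·D(w)`,
`Pr[abort] ≠ 1`): under the hypotheses of `tsum_wRun_some_toReal_mul_le`, `E_D[f] ≤ B`.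
[cite: MicciancioRegev2007, Thm. 5.23 (proof, pp. 30–31)] -/
theorem tsum_cond_toReal_mul_le (hSL : ∀ j, ((q * d : ℕ) : ℝ) • b j ∈ L)
    (hrep : ∀ a, gridClass b (q * d) L (rep a) = a) (O : Matrix (Fin n) (Fin m) (ZMod q) → PMF (Fin m → ℤ))
    (s β : ℝ) (hρ : (wRun b q d L rep hSL hrep O s β) none ≠ 1) {D : PMF L}
    (hD : ∀ w, (wRun b q d L rep hSL hrep O s β) (some w) = (1 - (wRun b q d L rep hSL hrep O s β) none) * D w)
    (f : V → ℝ) {M : ℝ} (hM : 0 ≤ M) (hf : ∀ v, |f v| ≤ M) {B : ℝ} (hB : 0 ≤ B)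
    (hcond : ∀ (cbar : Fin m → (Fin n → ZMod (q * d)) ⧸ gridImage b (q * d) L)
      (hv : Fin m → (QuotientAddGroup.mk' (gridImage b (q * d) L)).ker) (z : Fin m → ℤ),
      ((cbar, hv), (queryMatrix b q d L rep cbar hv, z)) ∈ (firstStage b q d L rep hSL hrep O s).support →
      IsSolution' (queryMatrix b q d L rep cbar hv) β z →
      ∑' y, ((condLaw b q d L rep s (fun _ => (0 : V)) cbar) y).toReal *
        f (output b q d L rep (((cbar, hv), (queryMatrix b q d L rep cbar hv, z)), y)) ≤ B) :
    ∑' w, (D w).toReal * f (w : V) ≤ B := by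
  rw [tsum_toReal_cond_eq hD hρ (fun w : L => f (w : V))]
  have hmain := tsum_wRun_some_toReal_mul_le b q d L rep hSL hrep O s β f hM hf hB hcond
  rw [← one_sub_wRun_none_toReal] at hmain
  have hlt : ((wRun b q d L rep hSL hrep O s β) none).toReal < 1 := by
    have h : (wRun b q d L rep hSL hrep O s β) none < 1 :=
      lt_of_le_of_ne ((wRun b q d L rep hSL hrep O s β).coe_le_one _) hρ
    have := (ENNReal.toReal_lt_toReal (PMF.apply_ne_top _ _) ENNReal.one_ne_top).2 h
    rwa [ENNReal.toReal_one] at this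
  have hpos : 0 < 1 - ((wRun b q d L rep hSL hrep O s β) none).toReal := by linarith
  calc (1 - ((wRun b q d L rep hSL hrep O s β) none).toReal)⁻¹ *
        ∑' w, ((wRun b q d L rep hSL hrep O s β) (some w)).toReal * f (w : V)
      ≤ (1 - ((wRun b q d L rep hSL hrep O s β) none).toReal)⁻¹ *
          (B * (1 - ((wRun b q d L rep hSL hrep O s β) none).toReal)) :=
        mul_le_mul_of_nonneg_left hmain (inv_nonneg.2 hpos.le)
    _ = B := by field_simp

/-! ### Transfer in `ℝ≥0∞` (unbounded nonnegative functions: eq. (18), second moments) -/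

omit [MeasurableSpace V] [BorelSpace V] [IsZLattice ℝ L] in
/-- **Per-condition bounds transfer to the success part of `wRun`, in `ℝ≥0∞`.**
[cite: MicciancioRegev2007, Thm. 5.23 (proof, pp. 30–31)] -/
theorem tsum_wRun_some_mul_le (hSL : ∀ j, ((q * d : ℕ) : ℝ) • b j ∈ L)
    (hrep : ∀ a, gridClass b (q * d) L (rep a) = a) (O : Matrix (Fin n) (Fin m) (ZMod q) → PMF (Fin m → ℤ))
    (s β : ℝ) (g : V → ℝ≥0∞) {B : ℝ≥0∞}
    (hcond : ∀ (cbar : Fin m → (Fin n → ZMod (q * d)) ⧸ gridImage b (q * d) L)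
      (hv : Fin m → (QuotientAddGroup.mk' (gridImage b (q * d) L)).ker) (z : Fin m → ℤ),
      ((cbar, hv), (queryMatrix b q d L rep cbar hv, z)) ∈ (firstStage b q d L rep hSL hrep O s).support →
      IsSolution' (queryMatrix b q d L rep cbar hv) β z →
      ∑' y, (condLaw b q d L rep s (fun _ => (0 : V)) cbar) y *
        g (output b q d L rep (((cbar, hv), (queryMatrix b q d L rep cbar hv, z)), y)) ≤ B) :
    ∑' w, (wRun b q d L rep hSL hrep O s β) (some w) * g (w : V) ≤
      B * (firstStage b q d L rep hSL hrep O s).toOuterMeasure {cr | IsSolution' cr.2.1 β cr.2.2} := by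
  set P₁ := firstStage b q d L rep hSL hrep O s with hP₁
  -- generic `ℝ≥0∞` push-forward and compound sums (kept local)
  have hmap : ∀ {Ω γ : Type _} (E : PMF Ω) (F : Ω → γ) (G : γ → ℝ≥0∞),
      ∑' o, (E.map F) o * G o = ∑' ω, E ω * G (F ω) := by
    intro Ω γ E F G
    simp_rw [PMF.map_apply, ← ENNReal.tsum_mul_right]
    rw [ENNReal.tsum_comm]
    refine tsum_congr fun ω => ?_
    rw [tsum_eq_single (F ω)]
    · rw [if_pos rfl]
    · intro o ho
      rw [if_neg ho, zero_mul]
  have hbind : ∀ {Ω γ : Type _} (p : PMF γ) (K : γ → PMF Ω) (H : Ω → ℝ≥0∞),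
      ∑' ω, (p.bind K) ω * H ω = ∑' c, p c * ∑' ω, K c ω * H ω := by
    intro Ω γ p K H
    simp_rw [PMF.bind_apply, ← ENNReal.tsum_mul_right, mul_assoc]
    rw [ENNReal.tsum_comm]
    exact tsum_congr fun c => ENNReal.tsum_mul_left
  have h1 : ∑' w, (wRun b q d L rep hSL hrep O s β) (some w) * g (w : V) =
      ∑' o, (wRun b q d L rep hSL hrep O s β) o * o.elim 0 (fun w : L => g (w : V)) :=
    tsum_some_eq_tsum (fun o => (wRun b q d L rep hSL hrep O s β) o * o.elim 0 (fun w : L => g (w : V)))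
      (by simp)
  rw [h1, wRun, hmap, experiment_zero_eq_pairing b q d L rep hSL hrep O s, hbind, ← hP₁,
    PMF.toOuterMeasure_apply, ← ENNReal.tsum_mul_left]
  refine ENNReal.tsum_le_tsum fun cr => ?_
  rw [hmap]
  by_cases hcr : cr ∈ P₁.support
  · obtain ⟨⟨cbar, hv⟩, ⟨A, z⟩⟩ := cr
    have hA : A = queryMatrix b q d L rep cbar hv :=
      query_eq_of_mem_support_firstStage b q d L rep hSL hrep O s hcr
    subst hA
    by_cases hsol : IsSolution' (queryMatrix b q d L rep cbar hv) β z
    · rw [Set.indicator_of_mem (show ((cbar, hv), (queryMatrix b q d L rep cbar hv, z)) ∈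
        {cr : ((Fin m → (Fin n → ZMod (q * d)) ⧸ gridImage b (q * d) L) ×
          (Fin m → (QuotientAddGroup.mk' (gridImage b (q * d) L)).ker)) ×
          (Matrix (Fin n) (Fin m) (ZMod q) × (Fin m → ℤ)) | IsSolution' cr.2.1 β cr.2.2} from hsol),
        mul_comm B]
      refine mul_le_mul' le_rfl ?_
      refine le_of_eq_of_le (tsum_congr fun y => ?_) (hcond cbar hv z hcr hsol)
      rw [dif_pos ⟨hsol, output_mem_of_isSolution' b q d L rep hSL cbar hv hsol y⟩]
      rfl
    · refine le_of_eq_of_le ?_ zero_le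
      rw [ENNReal.tsum_eq_zero.2 fun y => ?_, mul_zero]
      rw [dif_neg (fun h => hsol h.1)]
      exact mul_zero _
  · rw [(PMF.apply_eq_zero_iff P₁ _).2 hcr, zero_mul]
    exact zero_le

omit [MeasurableSpace V] [BorelSpace V] [IsZLattice ℝ L] in
/-- **Eq. (18)-type bounds for the conditional witness law `D`, in `ℝ≥0∞`**: `∑_w D(w) g(w) ≤ B`.
[cite: MicciancioRegev2007, Thm. 5.23 (proof, pp. 30–31)] -/
theorem tsum_cond_mul_le (hSL : ∀ j, ((q * d : ℕ) : ℝ) • b j ∈ L)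
    (hrep : ∀ a, gridClass b (q * d) L (rep a) = a) (O : Matrix (Fin n) (Fin m) (ZMod q) → PMF (Fin m → ℤ))
    (s β : ℝ) (hρ : (wRun b q d L rep hSL hrep O s β) none ≠ 1) {D : PMF L}
    (hD : ∀ w, (wRun b q d L rep hSL hrep O s β) (some w) = (1 - (wRun b q d L rep hSL hrep O s β) none) * D w)
    (g : V → ℝ≥0∞) {B : ℝ≥0∞}
    (hcond : ∀ (cbar : Fin m → (Fin n → ZMod (q * d)) ⧸ gridImage b (q * d) L)
      (hv : Fin m → (QuotientAddGroup.mk' (gridImage b (q * d) L)).ker) (z : Fin m → ℤ),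
      ((cbar, hv), (queryMatrix b q d L rep cbar hv, z)) ∈ (firstStage b q d L rep hSL hrep O s).support →
      IsSolution' (queryMatrix b q d L rep cbar hv) β z →
      ∑' y, (condLaw b q d L rep s (fun _ => (0 : V)) cbar) y *
        g (output b q d L rep (((cbar, hv), (queryMatrix b q d L rep cbar hv, z)), y)) ≤ B) :
    ∑' w, D w * g (w : V) ≤ B := by
  have hmain := tsum_wRun_some_mul_le b q d L rep hSL hrep O s β g hcond
  rw [← one_sub_wRun_none] at hmain
  have heq : ∑' w, (wRun b q d L rep hSL hrep O s β) (some w) * g (w : V) =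
      (1 - (wRun b q d L rep hSL hrep O s β) none) * ∑' w, D w * g (w : V) := by
    simp_rw [hD, mul_assoc]
    exact ENNReal.tsum_mul_left
  rw [heq, mul_comm B] at hmain
  have h0 : 1 - (wRun b q d L rep hSL hrep O s β) none ≠ 0 :=
    (tsub_pos_iff_lt.2 (lt_of_le_of_ne ((wRun b q d L rep hSL hrep O s β).coe_le_one _) hρ)).ne'
  have htop : 1 - (wRun b q d L rep hSL hrep O s β) none ≠ ∞ :=
    ne_top_of_le_ne_top ENNReal.one_ne_top tsub_le_self
  exact (ENNReal.mul_le_mul_iff_right h0 htop).1 hmain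

end WitnessLaw

end MicciancioRegev2007

end Literature.Algebra.EuclideanLattices

end
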